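import Summits.BirchSwinnertonDyer.BirchSwinnertonDyer.Theorems.GoldfeldAllTwistsTwoConverseTwinAdditiveTwoPrimesTwistSelmer
import HarnessLib

set_option linter.dupNamespace false -- namespace `…BirchSwinnertonDyer.BirchSwinnertonDyer…` is the cell's (D-0017 nested layout)
set_option autoImplicit false

/-!
# Twin″ (item 19140), LINE B⁗ T3-D part 3a: the type-β obstruction at `p` for the four split classes `−qp, 7qp, 2p, −14p` of the DUAL
# Selmer set `S′ = S(84qp, −28q²p²)` of `49a1^{(−2qp)}`

Cell `bsd-goldfeld`, seat `bsd-goldfeld-s1p-c3x` (gen 10); planner ORDER (cccxvii) «LINE B⁗ — TRANCHE 3», object T3-D (= N3), third file (local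
lemma only; the count `#S′ ≤ 4` and the descent follow). `--supports stmt-BirchSwinnertonDyer-19140` as a HELPER. FACT-FREE.

For a class `d = p·e` of `S′` with cofactor `d′ = p·e′` one has `e′e = −28q²` and, in the `ℤ_p`-chart, the reduced quadratic
`e′T² + 84q·T + e` with discriminant `7168q² = 7·(32q)²`; its roots are `T = −2q(21 ∓ 8u)/e′` (`u² = 7`), and under β
(`x⁴ = −7`, `a := x(x² − 3)/2`, `a² = r = (21 + x²)/2`, `r + 112/r = 21`) the numerators are squares: `21 ± 8u = (a ± 4u/a)²`. Hence `T` is a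
square only if `−2qe′` is — which fails for `e′ ∈ {28q, −4q, −14q², 2q²}` by `(−14/p) = (2/p) = (7q/p) = (−q/p) = −1`. With part 1 §1
(`not_isSoluble_padic_of_prime_dvd_coeffs_of_roots`) this kills the four split classes at `p` on the β sub-cells (memo
`ROUTE-S1PLUS/b4-c3xg10/T3D-DESCENT-KILLTABLE.md`). HONEST FRAMING: no `BSD(W,2)` is proved; BSD is not proved by any of this.

References: [SilvermanAEC2009] X.4.9–X.4.10.
-/

noncomputable section

open scoped Classical

namespace Summit.BirchSwinnertonDyer.BirchSwinnertonDyer.Theorems.GoldfeldGoodTwists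

/-- **`21 ± 8u` are non-zero squares under β**: with `x⁴ = −7`, `u² = 7` (and `448 ≠ 0`), putting `a = x(x² − 3)/2` (`a² = (21 + x²)/2`,
`a⁴ − 21a² + 112 = 0`) one has `(a ± 4u/a)² = 21 ± 8u` and `a ± 4u/a ≠ 0` (their product is `2a² − 21 = x² ≠ 0`). [folklore] -/
theorem exists_sq_eq_twentyOne_add_eight_mul_sqrt_seven {F : Type*} [Field F] [NeZero (2 : F)] {x u : F} (hx : x ^ 4 = -7)
    (hu : u ^ 2 = 7) (h448 : (448 : F) ≠ 0) :
    ∃ Np Nm : F, Np ≠ 0 ∧ Nm ≠ 0 ∧ 21 + 8 * u = Np * Np ∧ 21 - 8 * u = Nm * Nm := by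
  have h2 : (2 : F) ≠ 0 := NeZero.ne 2
  obtain ⟨a, ha⟩ : ∃ a : F, a = x * (x ^ 2 - 3) / 2 := ⟨_, rfl⟩
  have ha2 : a ^ 2 = (21 + x ^ 2) / 2 := by rw [ha]; exact sq_half_x_cube_sub_of_pow_four hx
  have h7 : (7 : F) ≠ 0 := fun h ↦ h448 (by rw [show (448 : F) = 64 * 7 by norm_num, h, mul_zero])
  have hx0 : x ≠ 0 := by rintro rfl; norm_num at hx; exact h7 hx
  have ha0 : a ≠ 0 := by
    intro h0
    rw [h0, zero_pow two_ne_zero, eq_comm, div_eq_zero_iff] at ha2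
    rcases ha2 with h | h
    · apply h448; linear_combination (21 - x ^ 2) * h + hx
    · exact h2 h
  -- `a⁴ − 21a² + 112 = 0`
  have hquad : a ^ 2 * a ^ 2 - 21 * a ^ 2 + 112 = 0 := by
    rw [ha2]; field_simp; linear_combination hx
  have hplus : (a + 4 * u / a) ^ 2 = 21 + 8 * u := by
    field_simp; linear_combination hquad + 16 * hu
  have hminus : (a - 4 * u / a) ^ 2 = 21 - 8 * u := by
    field_simp; linear_combination hquad + 16 * hu
  -- the product `(a + 4u/a)(a − 4u/a) = a² − 112/a² = 2a² − 21 = x²`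
  have hprod : (a + 4 * u / a) * (a - 4 * u / a) = x ^ 2 := by
    have e1 : (a + 4 * u / a) * (a - 4 * u / a) = 2 * a ^ 2 - 21 := by
      field_simp; linear_combination (-16 : F) * hu - hquad
    rw [e1, ha2]; field_simp; ring
  have hx2 : x ^ 2 ≠ 0 := pow_ne_zero 2 hx0
  refine ⟨a + 4 * u / a, a - 4 * u / a, fun h ↦ hx2 ?_, fun h ↦ hx2 ?_, ?_, ?_⟩
  · rw [← hprod, h, zero_mul]
  · rw [← hprod, h, mul_zero]
  · rw [← hplus]; ring
  · rw [← hminus]; ring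

/-- **The type-β root test for the split classes of `S′`.** In a field with `2, 448 ≠ 0`: `x⁴ = −7`, `u² = 7`, and
`e′T² + cT + e = 0` with `c = 84q`, `e′e = −28q²`, `e′ ≠ 0`, `−2qe′` a NON-square. Then `T` is not a square: the discriminant is
`(32qu)²`, so `T·e′ = −2q(21 ∓ 8u)`, and `21 ∓ 8u` is a non-zero square. [cite: SilvermanAEC2009, Example X.4.10] -/
theorem not_isSquare_root_typeBeta_dual {F : Type*} [Field F] [NeZero (2 : F)] {x u qF e' e c T : F} (hx : x ^ 4 = -7) (hu : u ^ 2 = 7)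
    (h448 : (448 : F) ≠ 0) (he' : e' ≠ 0) (hc : c = 84 * qF) (hee : e' * e = -28 * qF ^ 2)
    (hns : ¬ IsSquare (-2 * qF * e')) (hT : e' * T ^ 2 + c * T + e = 0) : ¬ IsSquare T := by
  obtain ⟨Np, Nm, hNp, hNm, hplus, hminus⟩ := exists_sq_eq_twentyOne_add_eight_mul_sqrt_seven hx hu h448
  have hδ : (32 * qF * u) ^ 2 = c ^ 2 - 4 * e' * e := by
    rw [hc]; linear_combination (1024 * qF ^ 2) * hu + 4 * hee
  rintro ⟨w, hw⟩
  apply hns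
  rcases quadratic_root_cases he' hδ hT with h | h
  · -- `T = (−84q + 32qu)/(2e′) = −2q(21 − 8u)/e′ = −2q·Nm²/e′`
    have hTe : T * e' = -2 * qF * Nm * Nm := by
      rw [h, hc]; field_simp; linear_combination (-4 * qF) * hminus
    refine ⟨e' * w / Nm, ?_⟩
    field_simp
    linear_combination (-1 : F) * hTe + e' * hw
  · -- `T = (−84q − 32qu)/(2e′) = −2q(21 + 8u)/e′ = −2q·Np²/e′`
    have hTe : T * e' = -2 * qF * Np * Np := by
      rw [h, hc]; field_simp; linear_combination (-4 * qF) * hplus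
    refine ⟨e' * w / Np, ?_⟩
    field_simp
    linear_combination (-1 : F) * hTe + e' * hw

end Summit.BirchSwinnertonDyer.BirchSwinnertonDyer.Theorems.GoldfeldGoodTwists

end
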